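import Mathlib
import HarnessLib
import Summits.Langlands.Langlands.Theses.TriangulineChamber

/-!
# `LiftB2CrysSplitP` (item stmt-Langlands-8575, support of route `TriangulineChamber`) — helpers

Structural position of the split-completely slice `LiftB2CrysSplitP` inside the route
`TriangulineChamber` of the `Langlands` summit:

* `not_dvd_discr_of_forall_not_sq_dvd` — the number-theoretic bridge (Dedekind's discriminant
  theorem, direction "unramified ⇒ `p ∤ disc`", from Mathlib's
  `NumberField.not_dvd_discr_iff_forall_mem`): if no prime `v` of `𝓞 F` above `p` has
  `v² ∣ (p)`, then `p ∤ disc F`.  The split-completely hypothesis of `LiftB2CrysSplitP`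
  (`N v = p ∧ ¬ v² ∣ (p)` for every `v ∣ p`) therefore puts `p` in the UNRAMIFIED regime.
* `LiftB2CrysSplitP_of_unramifiedP` — the slice is a sub-case of the crux `LiftB2CrysUnramifiedP`.
* `LiftB2CrysSplitP_of_generic` — the slice is a specialisation of the target `LiftB2CrysGeneric`
  (the planner's `splitP_of_generic`).

These are helpers (`--supports stmt-Langlands-8575`); they do not close the item, whose
unconditional form needs a term of `ReciprocityData F` (named fact
`Literature.NumberTheory.Automorphic.LocalLanglandsDatum.nonempty`) before anything else.
-/

set_option linter.dupNamespace false -- project-wide option (lakefile weak.linter.dupNamespace); `Summit.Langlands.Langlands` is the mandated namespace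

namespace Summit.Langlands.Langlands.Theorems.LiftB2CrysSplitP

open Summit.Langlands.Langlands.Theses.TriangulineChamber
open NumberField IsDedekindDomain

/-- **Dedekind's discriminant criterion, unramified direction** [folklore; Neukirch, *Algebraic
Number Theory*, III (2.12)]: for a number field `F` and a prime number `p`, if no nonzero prime
`v` of `𝓞 F` containing `p` satisfies `v ^ 2 ∣ (p)` (every ramification index above `p` is `1`),
then `p` does not divide the discriminant of `F`.  From Mathlib's
`NumberField.not_dvd_discr_iff_forall_mem` and `Ideal.ramificationIdx_eq_one_iff`. -/
theorem not_dvd_discr_of_forall_not_sq_dvd (F : Type*) [Field F] [NumberField F] (p : ℕ)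
    [hp : Fact p.Prime]
    (h : ∀ v : HeightOneSpectrum (𝓞 F), ((p : ℕ) : 𝓞 F) ∈ v.asIdeal →
      ¬ v.asIdeal ^ 2 ∣ Ideal.span {((p : ℕ) : 𝓞 F)}) :
    ¬ ((p : ℤ) ∣ NumberField.discr F) := by
  have hpZ : Prime (p : ℤ) := Nat.prime_iff_prime_int.mp hp.out
  rw [NumberField.not_dvd_discr_iff_forall_mem F (𝓞 F) hpZ]
  intro P hP hpP
  have hpP' : ((p : ℕ) : 𝓞 F) ∈ P := by simpa using hpP
  have hP0 : P ≠ ⊥ := by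
    rintro rfl
    rw [Ideal.mem_bot] at hpP'
    exact hp.out.ne_zero (by exact_mod_cast hpP')
  have hv := h ⟨P, hP, hP0⟩ hpP'
  haveI : P.LiesOver (Ideal.span {(p : ℤ)}) :=
    (Ideal.liesOver_span_iff hP.ne_top hpZ).mpr hpP
  have hmap : (Ideal.span {(p : ℤ)}).map (algebraMap ℤ (𝓞 F)) = Ideal.span {((p : ℕ) : 𝓞 F)} := by
    rw [Ideal.map_span, Set.image_singleton, map_natCast]
  rw [← Ideal.ramificationIdx_eq_one_iff,
    ← Ideal.ramificationIdx'_eq_ramificationIdx (Ideal.span {(p : ℤ)}) P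
      (by simpa using hpZ.ne_zero)]
  by_contra hne
  rw [← ne_eq, Ideal.ramificationIdx'_ne_one_iff
    (by rw [hmap, Ideal.span_singleton_le_iff_mem]; exact hpP'), hmap] at hne
  exact hv (Ideal.dvd_iff_le.mpr hne)

/-- The split-completely slice is a sub-case of the unramified crux [folklore]:
`LiftB2CrysUnramifiedP → LiftB2CrysSplitP` (a prime that splits completely is unramified,
`not_dvd_discr_of_forall_not_sq_dvd`; only the conjunct `¬ v² ∣ (p)` of the hypothesis is used). -/
theorem LiftB2CrysSplitP_of_unramifiedP (hU : LiftB2CrysUnramifiedP) : LiftB2CrysSplitP := by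
  intro F _ _ _ p _ hp hsplit
  exact hU F p hp (not_dvd_discr_of_forall_not_sq_dvd F p fun v hv => (hsplit v hv).2)

/-- The split-completely slice is a specialisation of the route's target [folklore]:
`LiftB2CrysGeneric → LiftB2CrysSplitP` (drop the splitting hypothesis; the planner's
`splitP_of_generic`). -/
theorem LiftB2CrysSplitP_of_generic (hG : LiftB2CrysGeneric) : LiftB2CrysSplitP := by
  intro F _ _ _ p _ hp _
  exact hG F p hp

/-! ### Calibration over `F = ℚ`: the slice already carries the local Langlands data

Every prime splits completely in `ℚ`, so `LiftB2CrysSplitP` specialises to `F = ℚ`, `p = 7`, and its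
`∃ RD : ReciprocityData ℚ` yields a local Langlands datum for EVERY completion `ℚ_v` — the formal
reason the item is blocked on the named fact
`Literature.NumberTheory.Automorphic.LocalLanglandsDatum.nonempty` (no term of `ReciprocityData F`
exists without it). -/

/-- `N (p) = p` in `𝓞 ℚ` [folklore]: the absolute norm of the ideal `(p)` of `𝓞 ℚ` generated by a
natural number `p` is `p` (`[𝓞 ℚ : ℤ] = [ℚ : ℚ] = 1`). -/
theorem absNorm_span_natCast_rat (p : ℕ) :
    Ideal.absNorm (Ideal.span {((p : ℕ) : 𝓞 ℚ)}) = p := by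
  rw [Ideal.absNorm_span_singleton]
  have e : ((p : ℕ) : 𝓞 ℚ) = algebraMap ℤ (𝓞 ℚ) (p : ℤ) := by simp
  rw [e, Algebra.norm_algebraMap, NumberField.RingOfIntegers.rank, Module.finrank_self, pow_one,
    Int.natAbs_natCast]

/-- Over `ℚ` the place `v ∋ p` has residue field of cardinality `p` [folklore]: `N v ∣ N (p) = p`
and `N v > 1`. -/
theorem rat_residueCard_eq (p : ℕ) [hp : Fact p.Prime] (v : HeightOneSpectrum (𝓞 ℚ))
    (hv : ((p : ℕ) : 𝓞 ℚ) ∈ v.asIdeal) : v.residueCard = p := by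
  have hle : Ideal.span {((p : ℕ) : 𝓞 ℚ)} ≤ v.asIdeal := by
    rwa [Ideal.span_singleton_le_iff_mem]
  have hdvd : v.residueCard ∣ p := by
    have h := Ideal.absNorm_dvd_absNorm_of_le hle
    rwa [absNorm_span_natCast_rat] at h
  rcases (Nat.dvd_prime hp.out).mp hdvd with h1 | h1
  · exact absurd h1 (ne_of_gt v.one_lt_residueCard)
  · exact h1

/-- Over `ℚ` no place is ramified [folklore]: `v² ∤ (p)` for the place `v ∋ p` (else
`p² = N(v²) ∣ N (p) = p`). -/
theorem rat_not_sq_dvd (p : ℕ) [hp : Fact p.Prime] (v : HeightOneSpectrum (𝓞 ℚ))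
    (hv : ((p : ℕ) : 𝓞 ℚ) ∈ v.asIdeal) : ¬ v.asIdeal ^ 2 ∣ Ideal.span {((p : ℕ) : 𝓞 ℚ)} := by
  intro h
  have h1 := Ideal.absNorm_dvd_absNorm_of_le (Ideal.le_of_dvd h)
  rw [map_pow, absNorm_span_natCast_rat] at h1
  have h2 : v.residueCard ^ 2 ∣ p := h1
  rw [rat_residueCard_eq p v hv] at h2
  have h3 := Nat.le_of_dvd hp.out.pos h2
  nlinarith [hp.out.two_le]

/-- Every prime `p` splits completely in `ℚ`, in the exact form of the item's hypothesis
[folklore]. -/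
theorem rat_splitsCompletely (p : ℕ) [Fact p.Prime] :
    ∀ v : HeightOneSpectrum (𝓞 ℚ), ((p : ℕ) : 𝓞 ℚ) ∈ v.asIdeal →
      v.residueCard = p ∧ ¬ v.asIdeal ^ 2 ∣ Ideal.span {((p : ℕ) : 𝓞 ℚ)} :=
  fun v hv => ⟨rat_residueCard_eq p v hv, rat_not_sq_dvd p v hv⟩

/-- **Calibration** [folklore]: `LiftB2CrysSplitP` (at `F = ℚ`, `p = 7`) already produces reciprocity
data for `ℚ`, i.e. a term of `ReciprocityData ℚ`. -/
theorem nonempty_reciprocityData_rat_of_splitP (h : LiftB2CrysSplitP) :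
    Nonempty (ReciprocityData ℚ) := by
  haveI : Fact (Nat.Prime 7) := ⟨by norm_num⟩
  obtain ⟨RD, -⟩ := h ℚ 7 le_rfl (rat_splitsCompletely 7)
  exact ⟨RD⟩

/-- **Calibration** [folklore]: `LiftB2CrysSplitP` implies that every completion `ℚ_v` carries a
local Langlands datum (`LocalLanglandsDatum (v.adicCompletion ℚ)`: Harris–Taylor's `rec` with its
six-clause characterisation) — the content of the unproved named fact
`Literature.NumberTheory.Automorphic.LocalLanglandsDatum.nonempty` at the completions of `ℚ`.  This is
why the item cannot close before that fact (or a construction of the data) lands. -/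
theorem nonempty_localLanglandsDatum_of_splitP (h : LiftB2CrysSplitP)
    (v : HeightOneSpectrum (𝓞 ℚ)) :
    Nonempty (Literature.NumberTheory.Automorphic.LocalLanglandsDatum (v.adicCompletion ℚ)) := by
  obtain ⟨RD⟩ := nonempty_reciprocityData_rat_of_splitP h
  exact ⟨RD.llc v⟩

end Summit.Langlands.Langlands.Theorems.LiftB2CrysSplitP
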